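import Summits.BirchSwinnertonDyer.BirchSwinnertonDyer.Theorems.ThetaPartnerAtTwoSignedControlAtTwoSignedKummerAtP
import Summits.BirchSwinnertonDyer.Rank1Residual.Additive.StrictSignedSelmerInftyLocal
import Literature.NumberTheory.GaloisRepresentations.CyclotomicDirichletDensity
import HarnessLib

/-!
# Membership in Kobayashi's `Sel^ε(E/K_∞) = ⋃ₙ res Sel^ε(E/K_n)` from LEVEL-`∞` data: a class of
# `Sel_{p^∞}(E/K_∞)` each of whose conjugates is, at every place above `p`, the restriction of a layer class
# satisfying Kobayashi's signed Kummer condition lies in `Sel^ε(E/K_∞)` (common-layer argument)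

Route `ThetaPartnerAtTwo` (TP2; crux shared with `ResidualThetaTransportAtTwo`), crux K4 `SignedControlAtTwo`
(stmt-BirchSwinnertonDyer-20309), line `eulerchar` v4, stub `stub_plusKimNoFiniteSubmoduleTwo` (KIM⁺@2). Seat
`prover-bsd-wall-tp2-p3-w2` (width seat 2/3). Part 2 of the KIM⁺ series: the plumbing that the «LIFT» assembly
for `Sel^ε` needs and the ♭ road does not (Sprung's `Sel♭(E/K_∞)` is cut out by local conditions OVER `K_∞`;
Kobayashi's `Sel^ε(E/K_∞)` is by Definition 1.1 the UNION of the images of the layer groups `Sel^ε(E/K_n)`, whose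
signed condition `E^ε(K_n·K_v) ⊗ ℚ_p/ℤ_p` lives at the finite layer `n`).

WHAT IS PROVED (namespace `…Theorems.SignedEC`; any number field `K`, prime `p`, `ℤ_p`-extension `κ`, sign `ε`;
`𝒦^ε_n(v) := localKummerOverOfEmb W p (κ.layerSubgroup n) (closureEmb K_v) (E^ε(K_n·K_v))` is Kobayashi's signed
Kummer condition at layer `n` and the chosen place above `v`, spelled out — no definition is introduced):
* §1 `resOfLe_mem_signedKummerLayer` — `res_{K_m/K_n} 𝒦^ε_n(v) ⊆ 𝒦^ε_m(v)` (`n ≤ m`: restriction preserves Kummer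
  classes, `E^ε(K_n·K_v) ≤ E^ε(K_m·K_v)` by `signedLocalPointsOfEmb_mono`); `resOfLe_mem_signedSelmerLayer` —
  `res_{K_m/K_n} Sel^ε(E/K_n) ⊆ Sel^ε(E/K_m)`.
* §2 `exists_layer_of_mem_signedSelmerInfty` — **`s ∈ Sel^ε(E/K_∞)` iff `s = h_n c` for some `c ∈ Sel^ε(E/K_n)`**
  (the union is directed by §1); hence every conjugate `conj_σ s` is `h_n d` with `d ∈ 𝒦^ε_n(v)` at every `v ∣ p`
  (`forall_exists_signedKummerLayer_of_mem_signedSelmerInfty`).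
* §3 `mem_signedSelmerInfty_of_forall_exists_signedKummerLayer` — **the converse (common layer)**: if the
  restriction maps `h_n` are injective (e.g. `E(K)[p] = 0`, Greenberg Lemma 3.1), `s ∈ Sel_{p^∞}(E/K_∞)`, and for
  every `v ∣ p` and `σ ∈ Γ_K` the conjugate `conj_σ s` is `h_n d` for some layer `n` and `d ∈ 𝒦^ε_n(v)`, then
  `s ∈ Sel^ε(E/K_∞)`: write `s = h_m y` with `y ∈ Sel(E/K_m)` (`Sel(E/K_∞) = lim→ Sel(E/K_m)`, tree
  `mem_selmerInfty_iff_exists_layer`); on `H¹(K_m, ·)` every `conj_σ` is a `conj_{γ^i}`, `i < p^m`; the places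
  above `p` are finitely many; so ONE layer `N` dominates all the layers of the finitely many data, and
  `res_{K_N/K_m} y ∈ Sel^ε(E/K_N)` by injectivity of `h_N`.
* §4 `mem_signedSelmerInfty_of_conjH1_sub_mem_of_exists_signedKummerLayer` — the form the «LIFT» assembly
  consumes: `s ∈ Sel(E/K_∞)`, `conj_σ s − s ∈ Sel^ε(E/K_∞)` for all `σ`, and at every `v ∣ p` the class `s`
  ITSELF is `h_n d` with `d ∈ 𝒦^ε_n(v)` ⇒ `s ∈ Sel^ε(E/K_∞)`.
HONEST FRAMING: THEOREMS ONLY (no definition, no named fact, no `sorry`), route-independent plumbing of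
Definition 1.1; nothing about any curve is asserted; closes no item by itself; BSD is not proved by any of this.

References: [Kobayashi2003] Def. 1.1 (p. 2), §2 p. 4, Prop. 8.12 (proof, p. 18); [GreenbergLNM1716] §3
Lemmas 3.1–3.2 (p. 86); [SerreGaloisCohomology1997] I.§2.2 Prop. 8.
-/

set_option autoImplicit false
-- the Theorems namespace of this sub repeats the summit name by design (D-0017 nested layout)
set_option linter.dupNamespace false

noncomputable section

open scoped Classical NumberField

open NumberField IsDedekindDomain

universe u

namespace Summit.BirchSwinnertonDyer.BirchSwinnertonDyer.Theorems.SignedEC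

open Literature.NumberTheory.EllipticCurves Literature.NumberTheory.GaloisRepresentations
  WeierstrassCurve ZpExtension Literature.NumberTheory.EllipticCurves.Kobayashi2003
  Summit.BirchSwinnertonDyer.BirchSwinnertonDyer.Theorems.FineSelmerLeSignedSelmer
  Summit.BirchSwinnertonDyer.Rank1Residual.Additive

variable {K : Type u} [Field K] [NumberField K] (W : WeierstrassCurve K) {p : ℕ} [Fact p.Prime]
  (κ : ZpExtension K p) (ε : ℤˣ)

/-! ## §1 Restriction down the layers preserves the signed Kummer condition and `Sel^ε(E/K_n)` -/

omit [NumberField K] in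
/-- **`res_{K_m/K_n} 𝒦^ε_n(v) ⊆ 𝒦^ε_m(v)`** (`n ≤ m`): a layer-`n` class in Kobayashi's signed Kummer condition at the
chosen place above `v` restricts to a layer-`m` class in the layer-`m` condition — restriction preserves Kummer
classes (`resOfLe_mem_localKummerOverOfEmb`) and `E^ε(K_n·K_v) ≤ E^ε(K_m·K_v)` (`signedLocalPointsOfEmb_mono`,
Kobayashi's «`C(m_{n−2}) ⊆ C(m_n)`»). [cite: Kobayashi2003, Def. 1.1 and Prop. 8.12 (proof, p. 18)] -/
theorem resOfLe_mem_signedKummerLayer {E : Type u} [Field E] [Algebra K E] {n m : ℕ} (hnm : n ≤ m)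
    {d : W.subgroupH1 p (κ.layerSubgroup n)}
    (hd : d ∈ localKummerOverOfEmb W p (κ.layerSubgroup n) (closureEmb (K := K) E)
      (signedLocalPoints κ E W ε n)) :
    W.resOfLe p (κ.layerSubgroup_antitone hnm) d ∈
      localKummerOverOfEmb W p (κ.layerSubgroup m) (closureEmb (K := K) E) (signedLocalPoints κ E W ε m) :=
  localKummerOverOfEmb_mono (signedLocalPointsOfEmb_mono κ (closureEmb (K := K) E) W ε hnm)
    (Kobayashi2003.resOfLe_mem_localKummerOverOfEmb W p (closureEmb (K := K) E) (κ.layerSubgroup_antitone hnm)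
      _ hd)

/-- **`res_{K_m/K_n} Sel^ε(E/K_n) ⊆ Sel^ε(E/K_m)`** (`n ≤ m`): the classical part by `resOfLe_mem_selmerGroupOver`, the
signed conditions by `conj_σ ∘ res = res ∘ conj_σ` (`conjH1_resOfLe_layer`) and §1's first lemma.
[cite: Kobayashi2003, Def. 1.1] [cite: GreenbergLNM1716, §1 Thm. 1.2 (the maps `s_n`)] -/
theorem resOfLe_mem_signedSelmerLayer {n m : ℕ} (hnm : n ≤ m) {c : W.subgroupH1 p (κ.layerSubgroup n)}
    (hc : c ∈ signedSelmerLayer W κ ε n) :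
    W.resOfLe p (κ.layerSubgroup_antitone hnm) c ∈ signedSelmerLayer W κ ε m := by
  rw [mem_signedSelmerLayer_iff] at hc ⊢
  refine ⟨W.resOfLe_mem_selmerGroupOver p (κ.layerSubgroup_antitone hnm) hc.1, fun v hv σ ↦ ?_⟩
  rw [conjH1_resOfLe_layer W κ hnm σ c]
  exact resOfLe_mem_signedKummerLayer W κ ε hnm (hc.2 v hv σ)

/-! ## §2 `Sel^ε(E/K_∞) = ⋃ₙ h_n Sel^ε(E/K_n)`: every class comes from ONE layer -/

/-- **`s ∈ Sel^ε(E/K_∞)` ⇒ `s = h_n c` for some layer `n` and `c ∈ Sel^ε(E/K_n)`** (Definition 1.1's union is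
directed: two layers are dominated by their maximum, §1, and `h_m ∘ res_{K_m/K_n} = h_n`).
[cite: Kobayashi2003, Def. 1.1] -/
theorem exists_layer_of_mem_signedSelmerInfty {s : W.subgroupH1 p κ.kerSubgroup}
    (hs : s ∈ signedSelmerInfty W κ ε) :
    ∃ (n : ℕ) (c : W.subgroupH1 p (κ.layerSubgroup n)), c ∈ signedSelmerLayer W κ ε n ∧
      W.layerToInfty κ n c = s := by
  refine AddSubgroup.iSup_induction (fun n => (signedSelmerLayer W κ ε n).map (W.layerToInfty κ n))
    (C := fun s => ∃ (n : ℕ) (c : W.subgroupH1 p (κ.layerSubgroup n)), c ∈ signedSelmerLayer W κ ε n ∧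
      W.layerToInfty κ n c = s) hs ?_ ?_ ?_
  · rintro n s ⟨c, hc, rfl⟩
    exact ⟨n, c, hc, rfl⟩
  · exact ⟨0, 0, zero_mem _, map_zero _⟩
  · rintro s t ⟨n, c, hc, rfl⟩ ⟨m, d, hd, rfl⟩
    refine ⟨max n m, W.resOfLe p (κ.layerSubgroup_antitone (le_max_left n m)) c +
      W.resOfLe p (κ.layerSubgroup_antitone (le_max_right n m)) d,
      add_mem (resOfLe_mem_signedSelmerLayer W κ ε (le_max_left n m) hc)
        (resOfLe_mem_signedSelmerLayer W κ ε (le_max_right n m) hd), ?_⟩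
    rw [map_add, layerToInfty_resOfLe_layer W κ (le_max_left n m), layerToInfty_resOfLe_layer W κ (le_max_right n m)]

/-- **Membership in `Sel^ε(E/K_∞)`, layer form**: `s ∈ Sel^ε(E/K_∞) ↔ ∃ n, ∃ c ∈ Sel^ε(E/K_n), h_n c = s`.
[cite: Kobayashi2003, Def. 1.1] -/
theorem mem_signedSelmerInfty_iff_exists_layer (s : W.subgroupH1 p κ.kerSubgroup) :
    s ∈ signedSelmerInfty W κ ε ↔ ∃ (n : ℕ) (c : W.subgroupH1 p (κ.layerSubgroup n)),
      c ∈ signedSelmerLayer W κ ε n ∧ W.layerToInfty κ n c = s := by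
  refine ⟨exists_layer_of_mem_signedSelmerInfty W κ ε, ?_⟩
  rintro ⟨n, c, hc, rfl⟩
  exact map_layerToInfty_signedSelmerLayer_le W κ ε n ⟨c, hc, rfl⟩

/-- **Every conjugate of a class of `Sel^ε(E/K_∞)` is, at every `v ∣ p`, the restriction of a layer class in the
signed Kummer condition**: `conj_σ s = h_n (conj_σ c)` with `conj_σ c ∈ Sel^ε(E/K_n) ⊆ 𝒦^ε_n(v)`.
[cite: Kobayashi2003, Def. 1.1] -/
theorem forall_exists_signedKummerLayer_of_mem_signedSelmerInfty {s : W.subgroupH1 p κ.kerSubgroup}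
    (hs : s ∈ signedSelmerInfty W κ ε) (v : HeightOneSpectrum (𝓞 K)) (hv : (p : 𝓞 K) ∈ v.asIdeal)
    (σ : Field.absoluteGaloisGroup K) :
    ∃ (n : ℕ) (d : W.subgroupH1 p (κ.layerSubgroup n)),
      d ∈ localKummerOverOfEmb W p (κ.layerSubgroup n) (closureEmb (K := K) (v.adicCompletion K))
        (signedLocalPoints κ (v.adicCompletion K) W ε n) ∧
      W.layerToInfty κ n d = W.conjH1 p κ.kerSubgroup σ s := by
  obtain ⟨n, c, hc, rfl⟩ := exists_layer_of_mem_signedSelmerInfty W κ ε hs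
  refine ⟨n, W.conjH1 p (κ.layerSubgroup n) σ c, ?_, W.layerToInfty_conjH1 κ σ c⟩
  exact ((mem_signedSelmerLayer_iff W κ ε n _).mp (conjH1_mem_signedSelmerLayer W κ ε n σ hc)).2 v hv 1
    |> fun h ↦ by rwa [W.conjH1_one_holds p (κ.layerSubgroup n), AddMonoidHom.id_apply] at h

/-! ## §3 The converse: a common layer for finitely many data -/

/-- **Membership in `Sel^ε(E/K_∞)` from level-`∞` data (common-layer argument).** Assume the restriction maps
`h_n : H¹(K_n, E[p^∞]) → H¹(K_∞, E[p^∞])` are injective (Greenberg Lemma 3.1: e.g. `E(K)[p] = 0`, tree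
`layerToInfty_injective_of_no_pTorsion`). If `s ∈ Sel_{p^∞}(E/K_∞)` and for every place `v ∣ p` and every
`σ ∈ Γ_K` the conjugate `conj_σ s` is `h_n d` for some layer `n` and some `d` in Kobayashi's signed Kummer condition
`𝒦^ε_n(v)`, then `s ∈ Sel^ε(E/K_∞)`. Proof: `s = h_m y`, `y ∈ Sel(E/K_m)` (`mem_selmerInfty_iff_exists_layer`);
`conj_σ y = conj_{γ^i} y` with `i < p^m` (`exists_conjH1_eq_conjH1_pow_of_lt`); the data for the finitely many
pairs `(v, i)` (finitely many places above `p`: tree `finite_setOf_natCast_mem`) live below one layer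
`N ≥ m`; then `conj_σ (res_{K_N/K_m} y) = res_{K_N/K_n} d_{v,i} ∈ 𝒦^ε_N(v)` by
injectivity of `h_N` and §1, i.e. `res_{K_N/K_m} y ∈ Sel^ε(E/K_N)`, and `s = h_N (res y)`.
[cite: Kobayashi2003, Def. 1.1] [cite: GreenbergLNM1716, §3 Lemmas 3.1–3.2 (p. 86)] -/
theorem mem_signedSelmerInfty_of_forall_exists_signedKummerLayer [W.IsElliptic]
    (hinjh : ∀ n, Function.Injective (W.layerToInfty κ n)) {s : W.subgroupH1 p κ.kerSubgroup}
    (hsel : s ∈ W.selmerInfty κ)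
    (hsgn : ∀ (v : HeightOneSpectrum (𝓞 K)), (p : 𝓞 K) ∈ v.asIdeal → ∀ σ : Field.absoluteGaloisGroup K,
      ∃ (n : ℕ) (d : W.subgroupH1 p (κ.layerSubgroup n)),
        d ∈ localKummerOverOfEmb W p (κ.layerSubgroup n) (closureEmb (K := K) (v.adicCompletion K))
          (signedLocalPoints κ (v.adicCompletion K) W ε n) ∧
        W.layerToInfty κ n d = W.conjH1 p κ.kerSubgroup σ s) :
    s ∈ signedSelmerInfty W κ ε := by
  obtain ⟨m, y, hy, rfl⟩ := (mem_selmerInfty_iff_exists_layer W κ _).mp hsel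
  obtain ⟨γ, hγ⟩ := κ.surjective (Multiplicative.ofAdd 1)
  have hγ' : κ.IsTopGenerator γ := hγ
  -- the finitely many places above `p`
  haveI : NeZero p := ⟨(Fact.out : p.Prime).ne_zero⟩
  set T : Finset (HeightOneSpectrum (𝓞 K)) := (finite_setOf_natCast_mem (K := K) (m := p)).toFinset with hT
  have hTmem : ∀ v : HeightOneSpectrum (𝓞 K), v ∈ T ↔ (p : 𝓞 K) ∈ v.asIdeal := fun v ↦ by
    rw [hT, Set.Finite.mem_toFinset]; rfl
  -- one layer datum for each pair `(v, i)`, `v ∣ p`, `i < p^m`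
  have key : ∀ vi : ↥T × Fin (p ^ m), ∃ (n : ℕ) (d : W.subgroupH1 p (κ.layerSubgroup n)),
      d ∈ localKummerOverOfEmb W p (κ.layerSubgroup n) (closureEmb (K := K) (vi.1.1.adicCompletion K))
        (signedLocalPoints κ (vi.1.1.adicCompletion K) W ε n) ∧
      W.layerToInfty κ n d = W.conjH1 p κ.kerSubgroup (γ ^ (vi.2 : ℕ)) (W.layerToInfty κ m y) :=
    fun vi ↦ hsgn vi.1.1 ((hTmem _).mp vi.1.2) (γ ^ (vi.2 : ℕ))
  choose nf df hdfK hdf using key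
  -- a common layer
  set N : ℕ := max m (Finset.univ.sup nf) with hN
  have hmN : m ≤ N := le_max_left _ _
  have hnN : ∀ vi, nf vi ≤ N := fun vi ↦ (Finset.le_sup (Finset.mem_univ vi)).trans (le_max_right _ _)
  set yN : W.subgroupH1 p (κ.layerSubgroup N) := W.resOfLe p (κ.layerSubgroup_antitone hmN) y with hyN
  have hcN : W.layerToInfty κ N yN = W.layerToInfty κ m y := layerToInfty_resOfLe_layer W κ hmN y
  rw [← hcN]
  refine map_layerToInfty_signedSelmerLayer_le W κ ε N ⟨yN, ?_, rfl⟩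
  change yN ∈ signedSelmerLayer W κ ε N
  rw [mem_signedSelmerLayer_iff]
  refine ⟨W.resOfLe_mem_selmerGroupOver p (κ.layerSubgroup_antitone hmN) hy, fun v hv σ ↦ ?_⟩
  -- `conj_σ y = conj_{γ^i} y` on `H¹(K_m, ·)`
  obtain ⟨i, hi, hσi⟩ := exists_conjH1_eq_conjH1_pow_of_lt W κ hγ' m σ y
  set vi : ↥T × Fin (p ^ m) := (⟨v, (hTmem v).mpr hv⟩, ⟨i, hi⟩) with hvi
  -- the datum for `(v, i)`, restricted to layer `N`, IS `conj_σ yN` (injectivity of `h_N`)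
  have heq : W.conjH1 p (κ.layerSubgroup N) σ yN =
      W.resOfLe p (κ.layerSubgroup_antitone (hnN vi)) (df vi) := by
    apply hinjh N
    rw [layerToInfty_resOfLe_layer W κ (hnN vi), hdf vi, hyN, conjH1_resOfLe_layer W κ hmN σ y, hσi,
      layerToInfty_resOfLe_layer W κ hmN, W.layerToInfty_conjH1 κ]
  rw [heq]
  exact resOfLe_mem_signedKummerLayer W κ ε (hnN vi) (hdfK vi)

/-! ## §4 The form consumed by the «LIFT» assembly -/

/-- **`s ∈ Sel(E/K_∞)`, `conj_σ s − s ∈ Sel^ε(E/K_∞)` (all `σ`), and `s` itself a restricted signed-Kummer layer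
class at every `v ∣ p` ⇒ `s ∈ Sel^ε(E/K_∞)`** (injective `h_n`). For each `σ`: `conj_σ s = (conj_σ s − s) + s`; the
first summand is `h_{n₁} d₁` with `d₁ ∈ 𝒦^ε_{n₁}(v)` (§2), the second is `h_{n₀} d₀` by hypothesis; restrict both
to the layer `max n₀ n₁` (§1) and apply §3. [cite: Kobayashi2003, Def. 1.1]
[cite: GreenbergLNM1716, §4 Lemma 4.7 (pp. 107–108)] -/
theorem mem_signedSelmerInfty_of_conjH1_sub_mem_of_exists_signedKummerLayer [W.IsElliptic]
    (hinjh : ∀ n, Function.Injective (W.layerToInfty κ n)) {s : W.subgroupH1 p κ.kerSubgroup}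
    (hsel : s ∈ W.selmerInfty κ)
    (hsub : ∀ σ : Field.absoluteGaloisGroup K, W.conjH1 p κ.kerSubgroup σ s - s ∈ signedSelmerInfty W κ ε)
    (hsgn : ∀ (v : HeightOneSpectrum (𝓞 K)), (p : 𝓞 K) ∈ v.asIdeal →
      ∃ (n : ℕ) (d : W.subgroupH1 p (κ.layerSubgroup n)),
        d ∈ localKummerOverOfEmb W p (κ.layerSubgroup n) (closureEmb (K := K) (v.adicCompletion K))
          (signedLocalPoints κ (v.adicCompletion K) W ε n) ∧
        W.layerToInfty κ n d = s) :
    s ∈ signedSelmerInfty W κ ε := by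
  refine mem_signedSelmerInfty_of_forall_exists_signedKummerLayer W κ ε hinjh hsel fun v hv σ ↦ ?_
  obtain ⟨n₁, d₁, hd₁, h₁⟩ := forall_exists_signedKummerLayer_of_mem_signedSelmerInfty W κ ε (hsub σ) v hv 1
  rw [W.conjH1_one_holds p κ.kerSubgroup, AddMonoidHom.id_apply] at h₁
  obtain ⟨n₀, d₀, hd₀, h₀⟩ := hsgn v hv
  refine ⟨max n₀ n₁, W.resOfLe p (κ.layerSubgroup_antitone (le_max_right n₀ n₁)) d₁ +
    W.resOfLe p (κ.layerSubgroup_antitone (le_max_left n₀ n₁)) d₀,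
    add_mem (resOfLe_mem_signedKummerLayer W κ ε (le_max_right n₀ n₁) hd₁)
      (resOfLe_mem_signedKummerLayer W κ ε (le_max_left n₀ n₁) hd₀), ?_⟩
  rw [map_add, layerToInfty_resOfLe_layer W κ (le_max_right n₀ n₁), layerToInfty_resOfLe_layer W κ (le_max_left n₀ n₁),
    h₁, h₀]
  abel

end Summit.BirchSwinnertonDyer.BirchSwinnertonDyer.Theorems.SignedEC

end
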